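import Mathlib
import Literature.Analysis.FluidPDE.VectorCalculus
import Summits.NavierStokesRegularity.NavierStokesRegularity.Theorems.UnthreadedDoorFluxStarvedDipoleFluxStarvationWindow
import Summits.NavierStokesRegularity.NavierStokesRegularity.Theorems.UnthreadedDoorFluxStarvedDipolePoleIdentity
import HarnessLib

/-!
# Route `UnthreadedDoor`, crux `PoloidalLiouville` (stmt-NavierStokesRegularity-1222), wall W1 — crux idea
# «flux-starved-dipoles» (ns-idea-15 g12/g13, `Cruxes/PoloidalLiouville/FluxStarvedDipoleSketch.lean`):
# the TIME-DEPENDENT AMPLITUDE IDENTITY `⟪∂ₜA − (A″ + (2/r)A′ − (2/r²)A), A⟫ = 0` at non-solid points (K1′, §Proof step 5′)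

The card's K1′ (`DipoleNeverAncient`) starts: "flux starvation gives `∂ₜa = ℓ` on `{a > 0}`, i.e.
`∂ₜw = w″ − (2/r² + ‖∂_rÂ‖²)w` for `w = r a`".  With the time-dependent lever `fluxStarvation` (p838637) in the tree, THIS FILE
proves the PDE half of that sentence at NON-SOLID points, as the time-dependent analogue of `poleIdentity_of_shellTangent`
(p837099):

* `poleIdentity_of_shellTangent_gen` — the pole identity for a general reduced scalar `Ψ = ΔT + ⟪W, ·−x₀⟫ + D'` on `S_r`:
  shell tangency ⇒ `⟪A″ + (2/r)A′ − (2/r²)A, A⟫(r) + r⟪W, A(r)⟫ = 0`;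
* `amplitudeIdentity_window` — on an open time set `S` (slices `u(t) ∈ C¹` divergence-free, `A, R` jointly `C³`, (E1) on
  `S × {x₀}ᶜ`): at every `t ∈ S` and every NON-SOLID radius `r` of `A(t,·)` (`A(t,r) ≠ 0`, `r(‖A(t,·)‖)′(r) ≠ ‖A(t,r)‖`),
  `⟪A″ + (2/r)A′ − (2/r²)A − ∂ₜA, A⟫(t,r) = 0` with `∂ₜA(t,r) = D(uncurry A)(t,r)[(1,0)]` — i.e. `a ∂ₜa = a ℓ` there
  (the non-solid set of `A(t,·)` is open in `r`, `fluxStarvation` gives tangency on a shell, and `∂ₜT` is affine on `S_r`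
  with `W = −∂ₜA(t,r)/r`).

What K1′ still needs (not here): the identity on the SOLID part of `{a > 0}` (or the inequality `∂ₜq ≤ q″ + (4/r)q′` for
`q = a/r` across it) and the parabolic mean-value endgame in `ℝ⁵ × ℝ` [XL].  HONEST LABEL: the dipole (`l = 1`) stratum of the
LINEAR kinematic shadow of W1 (critic V28: information-grade, W1 movement 0); `PoloidalLiouville` (1222), its wall
`stub_scalarLiouville` and the summit stay OPEN; NO Navier–Stokes regularity statement is proved.
`--supports stmt-NavierStokesRegularity-1222` (helper).  [folklore]
-/

noncomputable section

-- the summit and its single sub-problem share the name (CONVENTIONS §1)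
set_option linter.dupNamespace false

open Set Filter Topology InnerProductSpace
open scoped RealInnerProductSpace Laplacian
open Literature.Analysis.FluidPDE
open Summit.NavierStokesRegularity.NavierStokesRegularity.Theorems.PoloidalLiouville.HorizonTower (E3)

namespace Summit.NavierStokesRegularity.NavierStokesRegularity.Theorems.PoloidalLiouville.FluxStarvedDipole

/-! ### The pole identity for a general reduced scalar -/

/-- **POLE IDENTITY FROM SHELL TANGENCY, general reduced scalar** (as `poleIdentity_of_shellTangent`, p837099, for the law
`∇(⟪u,∇T⟫ − Ψ) × (x−x₀) = ∇⟪u, x−x₀⟫ × ∇T` with `Ψ = ΔT + ⟪W, · − x₀⟫ + D'` on `S_r(x₀)`, `Ψ` differentiable off the centre;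
for the time-dependent law (E1), `Ψ = ΔT − ∂ₜT`, `W = −∂ₜA(t,r)/r`).  If the drift is tangent to the spheres `S_s(x₀)` for `s`
near `r` and `A(r) ≠ 0`, then `⟪A″(r) + (2/r)A′(r) − (2/r²)A(r), A(r)⟫ + r⟪W, A(r)⟫ = 0`.  Proof as in p837099: on the shell
`∇L` is radial, so `L = ⟪u,∇T⟫ − Ψ` is constant on `S_r`; at the poles `⟪u,∇T⟫ = 0`, so `Ψ(p₊) = Ψ(p₋)`, i.e.
`2r(C₀ + ⟪W,n⟫) = 0` in a radial frame. [folklore] -/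
theorem poleIdentity_of_shellTangent_gen (u : E3 → E3) (x₀ : E3) (A : ℝ → E3) (R : ℝ → ℝ)
    (hu : ContDiff ℝ 1 u) (hA : ContDiffOn ℝ 3 A (Set.Ioi 0)) (hR : ContDiffOn ℝ 3 R (Set.Ioi 0)) {Ψ : E3 → ℝ}
    (hlaw : ∀ x ∈ ({x₀}ᶜ : Set (EuclideanSpace ℝ (Fin 3))),
      cross (gradient (fun z => ⟪u z, gradient (fun x => ⟪A ‖x - x₀‖, x - x₀⟫ / ‖x - x₀‖ + R ‖x - x₀‖) z⟫
          - Ψ z) x) (x - x₀)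
        = cross (gradient (fun z => ⟪u z, z - x₀⟫) x)
            (gradient (fun x => ⟪A ‖x - x₀‖, x - x₀⟫ / ‖x - x₀‖ + R ‖x - x₀‖) x))
    {r : ℝ} (hr : 0 < r) (hAr : A r ≠ 0) (hΨd : ∀ x : E3, x ≠ x₀ → DifferentiableAt ℝ Ψ x) {W : E3} {D' : ℝ}
    (hΨ : ∀ y : E3, ‖y‖ = r →
      Ψ (x₀ + y) = Δ (fun x => ⟪A ‖x - x₀‖, x - x₀⟫ / ‖x - x₀‖ + R ‖x - x₀‖) (x₀ + y) + ⟪W, y⟫ + D')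
    (htan : ∀ᶠ s in 𝓝 r, ∀ x, ‖x - x₀‖ = s → ⟪u x, x - x₀⟫ = 0) :
    ⟪iteratedDeriv 2 A r + (2 / r) • deriv A r - (2 / r ^ 2) • A r, A r⟫ + r * ⟪W, A r⟫ = 0 := by
  -- abbreviations
  set T : (EuclideanSpace ℝ (Fin 3)) → ℝ := fun x => ⟪A ‖x - x₀‖, x - x₀⟫ / ‖x - x₀‖ + R ‖x - x₀‖ with hTdef
  have hT : ∀ z, T z = ⟪A ‖z - x₀‖, z - x₀⟫ / ‖z - x₀‖ + R ‖z - x₀‖ := fun z => rfl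
  set L : (EuclideanSpace ℝ (Fin 3)) → ℝ := fun z => ⟪u z, gradient T z⟫ - Ψ z with hLdef
  -- (1) the shell of tangency
  obtain ⟨ε, hε, hball⟩ := Metric.eventually_nhds_iff.mp htan
  have hshell_open : IsOpen {z : (EuclideanSpace ℝ (Fin 3)) | dist ‖z - x₀‖ r < min ε r} :=
    isOpen_lt ((continuous_norm.comp (continuous_id.sub continuous_const)).dist continuous_const)
      continuous_const
  have hgradm : ∀ x : (EuclideanSpace ℝ (Fin 3)), dist ‖x - x₀‖ r < min ε r → gradient (fun z => ⟪u z, z - x₀⟫) x = 0 := by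
    intro x hx
    have hev : (fun z => ⟪u z, z - x₀⟫) =ᶠ[𝓝 x] fun _ => (0 : ℝ) := by
      filter_upwards [hshell_open.mem_nhds hx] with z hz
      exact hball (lt_of_lt_of_le hz (min_le_left _ _)) z rfl
    rw [gradient, hev.fderiv_eq, fderiv_const_apply, map_zero]
  -- (2) on the shell the law makes `∇L` radial
  have hLrad : ∀ x : (EuclideanSpace ℝ (Fin 3)), dist ‖x - x₀‖ r < min ε r → cross (gradient L x) (x - x₀) = 0 := by
    intro x hx
    have hxne : x ≠ x₀ := by
      intro h
      rw [h, sub_self, norm_zero, Real.dist_eq, zero_sub, abs_neg, abs_of_pos hr] at hx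
      exact absurd (lt_of_lt_of_le hx (min_le_right _ _)) (lt_irrefl _)
    have h := hlaw x hxne
    rw [hgradm x hx, ← crossCLM_apply (0 : (EuclideanSpace ℝ (Fin 3))), map_zero, zero_apply] at h
    exact h
  -- (3) `L` is differentiable off the centre
  have hLdiff : ∀ x : (EuclideanSpace ℝ (Fin 3)), x ≠ x₀ → DifferentiableAt ℝ L x := by
    intro x hx
    have h3 := dipole_contDiffAt hT hA hR hx
    exact ((hu.differentiable one_ne_zero x).inner ℝ (dipole_differentiableAt_gradient h3)).sub (hΨd x hx)
  -- (4) the unit axis `n = Â(r)` and sphere constancy of `L` on `S_r(x₀)`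
  set n : (EuclideanSpace ℝ (Fin 3)) := ‖A r‖⁻¹ • A r with hn
  have hAn0 : ‖A r‖ ≠ 0 := norm_ne_zero_iff.mpr hAr
  have hn1 : ‖n‖ = 1 := by rw [hn, norm_smul, norm_inv, norm_norm, inv_mul_cancel₀ hAn0]
  have hAn : A r = ‖A r‖ • n := by rw [hn, smul_smul, mul_inv_cancel₀ hAn0, one_smul]
  clear_value n
  have hnorm : ∀ s : ℝ, s = r ∨ s = -r → ‖s • n‖ = r := by
    rintro s (h | h)
    · rw [h, norm_smul, hn1, mul_one, Real.norm_eq_abs, abs_of_pos hr]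
    · rw [h, norm_smul, hn1, mul_one, norm_neg, Real.norm_eq_abs, abs_of_pos hr]
  have hpole : L (x₀ + r • n) = L (x₀ + (-r) • n) := by
    have hQd : ∀ y : (EuclideanSpace ℝ (Fin 3)), ‖y‖ = r → DifferentiableAt ℝ (fun y => L (x₀ + y)) y := by
      intro y hy
      have hy0 : x₀ + y ≠ x₀ := by
        intro h
        have : y = 0 := by simpa using h
        rw [this, norm_zero] at hy
        exact hr.ne' hy.symm
      exact (differentiableAt_comp_add_left x₀).mpr (hLdiff _ hy0)
    have hQr : ∀ y : (EuclideanSpace ℝ (Fin 3)), ‖y‖ = r → cross (gradient (fun y => L (x₀ + y)) y) y = 0 := by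
      intro y hy
      have hg : gradient (fun y => L (x₀ + y)) y = gradient L (x₀ + y) := by
        simp only [gradient, fderiv_comp_add_left]
      have hmem : dist ‖(x₀ + y) - x₀‖ r < min ε r := by
        rw [add_sub_cancel_left, hy, dist_self]; positivity
      have h := hLrad (x₀ + y) hmem
      rw [add_sub_cancel_left] at h
      rw [hg]; exact h
    exact Antidynamo.sphereConst_of_cross_gradient_eq_zero_on hr hQd hQr (hnorm r (Or.inl rfl))
      (hnorm (-r) (Or.inr rfl))
  -- (5) at the poles `⟪u, ∇T⟫ = 0`
  have htan_r : ∀ x, ‖x - x₀‖ = r → ⟪u x, x - x₀⟫ = 0 := hball (by rw [dist_self]; exact hε)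
  have hinner0 : ∀ s : ℝ, s = r ∨ s = -r → ⟪u (x₀ + s • n), gradient T (x₀ + s • n)⟫ = 0 := by
    intro s hs
    have hs0 : s ≠ 0 := by
      rcases hs with h | h
      · rw [h]; exact hr.ne'
      · rw [h]; exact neg_ne_zero.mpr hr.ne'
    have hnrm : ‖x₀ + s • n - x₀‖ = r := by rw [add_sub_cancel_left]; exact hnorm s hs
    have hp : x₀ + s • n ≠ x₀ := by
      intro h
      have h' : ‖x₀ + s • n - x₀‖ = 0 := by rw [h, sub_self, norm_zero]
      rw [hnrm] at h'
      exact hr.ne' h'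
    have hw : ⟪x₀ + s • n - x₀, u (x₀ + s • n)⟫ = 0 := by
      rw [real_inner_comm]; exact htan_r _ hnrm
    have hAw : ⟪A ‖x₀ + s • n - x₀‖, u (x₀ + s • n)⟫ = 0 := by
      have hsn : ⟪s • n, u (x₀ + s • n)⟫ = 0 := by rwa [add_sub_cancel_left] at hw
      rw [real_inner_smul_left] at hsn
      have hn0 : ⟪n, u (x₀ + s • n)⟫ = 0 := (mul_eq_zero.mp hsn).resolve_left hs0
      rw [hnrm, hAn, real_inner_smul_left, hn0, mul_zero]
    rw [real_inner_comm, gradient, InnerProductSpace.toDual_symm_apply]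
    exact dipole_fderiv_apply_eq_zero hT hA hR hp hw hAw
  -- (6) the Laplacian at the two poles in an adapted frame
  obtain ⟨b, hb0, -, hb1, hb2⟩ := NetFlux.exists_orthonormalBasis_radial hn1
  obtain ⟨C, D, hC, hΔ⟩ := dipole_laplacian_sphere hT hA hR b hr
  have hΔs : ∀ s : ℝ, s = r ∨ s = -r → Ψ (x₀ + s • n) = s * C 0 + D + s * ⟪W, n⟫ + D' := by
    intro s hs
    rw [hΨ (s • n) (hnorm s hs), hΔ (s • n) (hnorm s hs), Fin.sum_univ_three, hb0, real_inner_smul_right,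
      real_inner_smul_right, real_inner_smul_right, real_inner_smul_right, hb1, hb2, real_inner_self_eq_norm_sq, hn1]
    ring
  -- (7) assemble: `L(p₊) = L(p₋)` and `⟪u,∇T⟫(p±) = 0` give `Ψ(p₊) = Ψ(p₋)`, i.e. `2 r (C₀ + ⟪W, n⟫) = 0`
  have hC0 : C 0 + ⟪W, n⟫ = 0 := by
    have h1 := hinner0 r (Or.inl rfl)
    have h2 := hinner0 (-r) (Or.inr rfl)
    have h3 := hΔs r (Or.inl rfl)
    have h4 := hΔs (-r) (Or.inr rfl)
    have h5 : L (x₀ + r • n) = ⟪u (x₀ + r • n), gradient T (x₀ + r • n)⟫ - Ψ (x₀ + r • n) := rfl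
    have h6 : L (x₀ + (-r) • n) = ⟪u (x₀ + (-r) • n), gradient T (x₀ + (-r) • n)⟫ - Ψ (x₀ + (-r) • n) :=
      rfl
    have h7 : r * (C 0 + ⟪W, n⟫) = 0 := by linarith [hpole, h1, h2, h3, h4, h5, h6]
    rcases mul_eq_zero.mp h7 with h | h
    · exact absurd h hr.ne'
    · exact h
  -- (8) the pole identity
  have hval := hC 0
  rw [hb0] at hval
  have hX : ⟪iteratedDeriv 2 A r + (2 / r) • deriv A r - (2 / r ^ 2) • A r, n⟫ + r * ⟪W, n⟫ = 0 := by
    rw [inner_sub_left, inner_add_left, real_inner_smul_left, real_inner_smul_left]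
    have h : r * (C 0 + ⟪W, n⟫) = 0 := by rw [hC0, mul_zero]
    rw [hval] at h
    have hrr : r * r⁻¹ = 1 := mul_inv_cancel₀ hr.ne'
    linear_combination h
      - (⟪iteratedDeriv 2 A r, n⟫ + 2 / r * ⟪deriv A r, n⟫ - 2 / r ^ 2 * ⟪A r, n⟫) * hrr
  rw [hn, inner_smul_right, inner_smul_right] at hX
  have h' : ‖A r‖⁻¹ * (⟪iteratedDeriv 2 A r + (2 / r) • deriv A r - (2 / r ^ 2) • A r, A r⟫ + r * ⟪W, A r⟫) = 0 := by
    linear_combination hX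
  rcases mul_eq_zero.mp h' with h | h
  · exact absurd h (inv_ne_zero hAn0)
  · exact h

/-! ### The time-dependent amplitude identity at non-solid points -/

/-- **TIME-DEPENDENT AMPLITUDE IDENTITY AT NON-SOLID POINTS** (K1′, card §Proof step 5′, PDE half).  On an open time set `S`:
slices `u(t) ∈ C¹` divergence-free, `A, R` jointly `C³` on `S × (0,∞)`, the law (E1) on `S × {x₀}ᶜ` for the turning-axis dipole
potential (sketch `KinematicLawOn S u (dipolePotentialT x₀ A R) x₀`, unfolded).  Then at every `t ∈ S` and every non-solid radius
`r` of `A(t,·)`: `⟪A″ + (2/r)A′ − (2/r²)A − ∂ₜA, A⟫(t,r) = 0`, `∂ₜA(t,r) = D(uncurry A)(t,r)[(1,0)]` (`= d/ds A(s,r)|ₛ₌ₜ`,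
`slice_hasDerivAt_left`). [folklore] -/
theorem amplitudeIdentity_window :
    ∀ (S : Set ℝ) (u : ℝ → E3 → E3) (x₀ : E3) (A : ℝ → ℝ → E3) (R : ℝ → ℝ → ℝ), IsOpen S →
      (∀ t ∈ S, ContDiff ℝ 1 (u t)) → (∀ t ∈ S, Literature.Analysis.FluidPDE.VectorCalculus.IsDivFree (u t)) →
      ContDiffOn ℝ 3 (Function.uncurry A) (S ×ˢ Set.Ioi 0) → ContDiffOn ℝ 3 (Function.uncurry R) (S ×ˢ Set.Ioi 0) →
      (∀ t ∈ S, ∀ x, x ≠ x₀ →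
        cross (gradient (fun z => deriv (fun s => ⟪A s ‖z - x₀‖, z - x₀⟫ / ‖z - x₀‖ + R s ‖z - x₀‖) t
            + ⟪u t z, gradient (fun x => ⟪A t ‖x - x₀‖, x - x₀⟫ / ‖x - x₀‖ + R t ‖x - x₀‖) z⟫
            - Δ (fun x => ⟪A t ‖x - x₀‖, x - x₀⟫ / ‖x - x₀‖ + R t ‖x - x₀‖) z) x) (x - x₀)
          = cross (gradient (fun z => ⟪u t z, z - x₀⟫) x)
              (gradient (fun x => ⟪A t ‖x - x₀‖, x - x₀⟫ / ‖x - x₀‖ + R t ‖x - x₀‖) x)) →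
      ∀ t ∈ S, ∀ r > 0, A t r ≠ 0 → r * deriv (fun s => ‖A t s‖) r ≠ ‖A t r‖ →
        ⟪iteratedDeriv 2 (A t) r + (2 / r) • deriv (A t) r - (2 / r ^ 2) • A t r
            - fderiv ℝ (Function.uncurry A) (t, r) ((1 : ℝ), (0 : ℝ)), A t r⟫ = 0 := by
  intro S u x₀ A R hS hu hdiv hA hR hlaw t ht r hr hAr hsol
  -- the slices at time `t`
  have hAt : ContDiffOn ℝ 3 (A t) (Ioi 0) := slice_contDiffOn_right hA ht
  have hRt : ContDiffOn ℝ 3 (R t) (Ioi 0) := slice_contDiffOn_right hR ht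
  set T : E3 → ℝ := fun x => ⟪A t ‖x - x₀‖, x - x₀⟫ / ‖x - x₀‖ + R t ‖x - x₀‖ with hTdef
  have hT : ∀ z, T z = ⟪A t ‖z - x₀‖, z - x₀⟫ / ‖z - x₀‖ + R t ‖z - x₀‖ := fun z => rfl
  -- time partials and `∂ₜT` off the centre (as in `fluxStarvation`)
  obtain ⟨A₁, hA₁⟩ : ∃ A₁ : ℝ → E3, A₁ = fun ρ => fderiv ℝ (Function.uncurry A) (t, ρ) ((1 : ℝ), (0 : ℝ)) := ⟨_, rfl⟩
  obtain ⟨R₁, hR₁⟩ : ∃ R₁ : ℝ → ℝ, R₁ = fun ρ => fderiv ℝ (Function.uncurry R) (t, ρ) ((1 : ℝ), (0 : ℝ)) := ⟨_, rfl⟩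
  have hA₁c : ContDiffOn ℝ 2 A₁ (Ioi 0) := by rw [hA₁]; exact slice_fderiv_contDiffOn hA hS ht
  have hR₁c : ContDiffOn ℝ 2 R₁ (Ioi 0) := by rw [hR₁]; exact slice_fderiv_contDiffOn hR hS ht
  obtain ⟨Td, hTd⟩ : ∃ Td : E3 → ℝ, Td = fun z => ⟪A₁ ‖z - x₀‖, z - x₀⟫ / ‖z - x₀‖ + R₁ ‖z - x₀‖ := ⟨_, rfl⟩
  have hTd' : ∀ z, Td z = ⟪A₁ ‖z - x₀‖, z - x₀⟫ / ‖z - x₀‖ + R₁ ‖z - x₀‖ := fun z => by rw [hTd]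
  have hdot : ∀ z : E3, z ≠ x₀ →
      deriv (fun s => ⟪A s ‖z - x₀‖, z - x₀⟫ / ‖z - x₀‖ + R s ‖z - x₀‖) t = Td z := by
    intro z hz
    have hρ : 0 < ‖z - x₀‖ := norm_pos_iff.mpr (sub_ne_zero.mpr hz)
    have h1 : HasDerivAt (fun s => A s ‖z - x₀‖) (A₁ ‖z - x₀‖) t := by
      rw [hA₁]; exact slice_hasDerivAt_left hA hS ht hρ
    have h2 : HasDerivAt (fun s => R s ‖z - x₀‖) (R₁ ‖z - x₀‖) t := by
      rw [hR₁]; exact slice_hasDerivAt_left hR hS ht hρ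
    have h : HasDerivAt (fun s => ⟪A s ‖z - x₀‖, z - x₀⟫ / ‖z - x₀‖ + R s ‖z - x₀‖)
        ((⟪A t ‖z - x₀‖, (0 : E3)⟫ + ⟪A₁ ‖z - x₀‖, z - x₀⟫) / ‖z - x₀‖ + R₁ ‖z - x₀‖) t :=
      ((h1.inner ℝ (hasDerivAt_const t (z - x₀))).div_const ‖z - x₀‖).add h2
    rw [h.deriv, hTd', inner_zero_right, zero_add]
  obtain ⟨Ψ, hΨ⟩ : ∃ Ψ : E3 → ℝ, Ψ = fun z => Δ T z - Td z := ⟨_, rfl⟩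
  have hΨd : ∀ z : E3, z ≠ x₀ → DifferentiableAt ℝ Ψ z := by
    intro z hz
    have h3 := dipole_contDiffAt hT hAt hRt hz
    have h4 : ContDiffAt ℝ 2 Td z := dipole_contDiffAt_of hTd' hA₁c hR₁c hz
    rw [hΨ]
    exact (dipole_differentiableAt_laplacian h3).sub (h4.differentiableAt (by norm_num))
  have hΨs : ∀ y : E3, ‖y‖ = r → Ψ (x₀ + y) = Δ T (x₀ + y) + ⟪-(r⁻¹ • A₁ r), y⟫ + (-(R₁ r)) := by
    intro y hy
    rw [hΨ, hTd]
    simp only [add_sub_cancel_left, hy]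
    rw [inner_neg_left, real_inner_smul_left, div_eq_inv_mul]
    ring
  have hlaw' : ∀ x ∈ ({x₀}ᶜ : Set E3),
      cross (gradient (fun z => ⟪u t z, gradient T z⟫ - Ψ z) x) (x - x₀)
        = cross (gradient (fun z => ⟪u t z, z - x₀⟫) x) (gradient T x) := by
    intro x hx'
    have hxne : x ≠ x₀ := hx'
    have h := hlaw t ht x hxne
    have hev : (fun z => deriv (fun s => ⟪A s ‖z - x₀‖, z - x₀⟫ / ‖z - x₀‖ + R s ‖z - x₀‖) t
        + ⟪u t z, gradient T z⟫ - Δ T z) =ᶠ[𝓝 x] (fun z => ⟪u t z, gradient T z⟫ - Ψ z) := by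
      filter_upwards [isOpen_compl_singleton.mem_nhds hxne] with z hz
      rw [hdot z hz, hΨ]
      ring
    have hg : gradient (fun z => deriv (fun s => ⟪A s ‖z - x₀‖, z - x₀⟫ / ‖z - x₀‖ + R s ‖z - x₀‖) t
        + ⟪u t z, gradient T z⟫ - Δ T z) x = gradient (fun z => ⟪u t z, gradient T z⟫ - Ψ z) x :=
      hev.gradient_eq
    rw [← hg]
    exact h
  -- the non-solid set of `A(t,·)` is open in `r`: tangency on a shell, by `fluxStarvation`
  have hV : ∀ᶠ s in 𝓝 r, 0 < s ∧ A t s ≠ 0 ∧ s * deriv (fun s => ‖A t s‖) s ≠ ‖A t s‖ := by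
    have hopen : IsOpen (Set.Ioi (0 : ℝ) ∩ (A t) ⁻¹' ({0}ᶜ : Set E3)) :=
      hAt.continuousOn.isOpen_inter_preimage isOpen_Ioi isOpen_compl_singleton
    have hmem : r ∈ Set.Ioi (0 : ℝ) ∩ (A t) ⁻¹' ({0}ᶜ : Set E3) := ⟨hr, hAr⟩
    have haV : ContDiffOn ℝ 3 (fun s => ‖A t s‖) (Set.Ioi (0 : ℝ) ∩ (A t) ⁻¹' ({0}ᶜ : Set E3)) :=
      (hAt.mono Set.inter_subset_left).norm ℝ fun s hs => hs.2
    have hφ : ContinuousOn (fun s => s * deriv (fun s => ‖A t s‖) s - ‖A t s‖)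
        (Set.Ioi (0 : ℝ) ∩ (A t) ⁻¹' ({0}ᶜ : Set E3)) :=
      (continuousOn_id.mul (haV.continuousOn_deriv_of_isOpen hopen (by norm_num))).sub haV.continuousOn
    have hφr : ContinuousAt (fun s => s * deriv (fun s => ‖A t s‖) s - ‖A t s‖) r := hφ.continuousAt (hopen.mem_nhds hmem)
    have hne : (fun s => s * deriv (fun s => ‖A t s‖) s - ‖A t s‖) r ≠ 0 := fun h => hsol (sub_eq_zero.mp h)
    filter_upwards [hφr.eventually_ne hne, hopen.mem_nhds hmem] with s hs hsV
    exact ⟨hsV.1, hsV.2, fun h => hs (sub_eq_zero.mpr h)⟩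
  have htan : ∀ᶠ s in 𝓝 r, ∀ x, ‖x - x₀‖ = s → ⟪u t x, x - x₀⟫ = 0 := by
    filter_upwards [hV] with s hs
    exact fluxStarvation S u x₀ A R hS hu hdiv hA hR hlaw t ht s hs.1 ⟨hs.2.1, hs.2.2⟩
  -- the pole identity with `W = −∂ₜA(t,r)/r`
  have hP := poleIdentity_of_shellTangent_gen (u t) x₀ (A t) (R t) (hu t ht) hAt hRt hlaw' hr hAr hΨd hΨs htan
  rw [inner_neg_left, real_inner_smul_left] at hP
  simp only [hA₁] at hP
  rw [inner_sub_left]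
  have hrr : r * r⁻¹ = 1 := mul_inv_cancel₀ hr.ne'
  linear_combination hP + ⟪fderiv ℝ (Function.uncurry A) (t, r) ((1 : ℝ), (0 : ℝ)), A t r⟫ * hrr

end Summit.NavierStokesRegularity.NavierStokesRegularity.Theorems.PoloidalLiouville.FluxStarvedDipole

end
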